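import Summits.QuantumFields.YangMills.Theorems.BalabanUVNodesN15KingModelHeatKernelCovariantFullPropagatorWoodbury
import HarnessLib

/-!
# BalabanUVNodes ∕ N15 — THE KING-MODEL RUNG (PART Ϻ-g): ★★★★ THE η-UNIFORM INVERSE-SQUARE LAW FOR THE FULL BACKGROUND PROPAGATOR AT EVERY UNITARY LINK FIELD —
# `L²·‖(A₀(U)⁻¹)_{uv}‖ ≤ C^U_full(a,m²)∕(1 + dist(u,v)²)` on the fine four-torus `(ℤ∕LM₀)⁴`, for EVERY unitary `U`, EVERY tree contour system, EVERY block size `L ≥ 1`, EVERY volume `M₀ ≥ 1`, any fibre;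
# `C^U_full = (34016+10∕m²)(1 + 98·C′S′∕m²) + 50·C′(1+κ′⁻²)∕m⁴`, `C′ = a + 2a²e²∕m²`, `κ′ = ctRate(m²,a,3)`, `S′ = latticeConst 4 κ′` — the mass floor only, NO curvature hypothesis
# (Track A, DAG node N15 = NE2; FAN-OUT v1.1 §N15 s3 «KING-MODEL RUNG … + what the curved case adds»; count-neutral)

HONEST FRAMING.  Count-neutral (cell `pub-ymgap`, seat `pub-ymgap-dag-n15-e` g56; `--supports stmt-QuantumFields-27247 --as helper` = K3ᴬ, KEY MAP v3).  King's one-level comparison model with Bałaban's covariant block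
mean ([B9] (3.19)) on the cubic fine four-torus, King's scaling `c = L²`: the FULL background propagator `A₀(U)⁻¹ = (−L²Δ_U + m² + aQ(U)^*Q(U))⁻¹` ([B9] (3.24)–(3.26), King (2.13)).  Ϻ-d proved the η-uniform
inverse-square law at `U ≡ 1`; Ϻ-f reduced the curved block correction to King's SCALAR double sum `L^{−4}Σ_{b,b′}S_u(b)‖Δ_eff(U)_{bb′}‖S^v(b′)` with `‖Δ_eff(U)_{bb′}‖ ≤ C′e^{−κ′d_M(b,b′)}` from the mass floor
(Ϧ∕Ϥ-k).  THIS FILE runs Ϻ-c's three-leg books for an ARBITRARY non-negative block kernel with exponential decay (§1) and concludes (§2):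
* §1 (generic `Δ̃ ≥ 0` with `Δ̃(b,b′) ≤ Ce^{−κ·d_M(b,b′)}`, `C ≥ 0`, `κ > 0`): `sum_le_of_exp_decay`∕`…'` (`ΣΔ̃ ≤ C·latticeConst 4 κ`), ★★ `summand_le_three_terms_of_decay`, ★★ `doubleSum_le_far_of_decay`, ★★★
  **`mul_doubleSum_le_powerLaw_of_decay`** (ALL `u, v`: `L²·L^{−4}Σ_{b,b′}S_u(b)Δ̃(b,b′)S^v(b′) ≤ (98C₀CS_κ∕m² + 50C(1+κ⁻²)∕m⁴)∕(1+dist(u,v)²)`, `C₀ = 34016+10∕m²`, `S_κ = latticeConst 4 κ` — near zone `D < 6`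
  by `ΣS = 1∕m²`, far zone by the three legs);
* §2 ★★★★ **`king_fullPropU_correction_powerLaw`** (EVERY unitary `U`: `L²‖(A₀(U)⁻¹)_{uv} − (M_U⁻¹)_{uv}‖ ≤ C^U_corr∕(1+dist²)`), ★★★★ **`king_fullPropU_powerLaw_eta_uniform`** (EVERY unitary `U`, ALL `u,v`, every `L`,
  every `M₀`: `L²‖(A₀(U)⁻¹)_{uv}‖ ≤ C^U_full∕(1+dist(u,v)²)` — the fine blocks of the full background propagator obey the continuum `|x−y|⁻²` law uniformly in the spacing, AT EVERY UNITARY BACKGROUND,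
  with constants depending on `(a, m²)` ONLY (not on `U`, `L`, `M₀`, the fibre or the contour system)), ★★★ `king_fullPropU_entry_powerLaw` (every fibre entry), ★★★ `king_fullPropU_powerLaw_exists`
  (`∃ C(a,m²) ∀ L ∀ M₀ ∀ T ∀ unitary U ∀ u v`), ★★★ `king_fullProp_what_the_curved_case_adds_final` (the flat law Ϻ-d and the curved law side by side: the curved case adds NOTHING but the replacement
  `(C_Δ, κ_A) ↦ (a + 2a²e²∕m², ctRate(m²,a,3))` of King's flat decay constants by the mass-floor ones).
HONEST SCOPE: King's one-level comparison model (one renormalization step, flat block profile, periodic b.c.), `d+1 = 4`, `c = L²`, massive `m² > 0`, `a > 0`; the MASS floor makes the constants blow up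
as `m → 0` faster than at `U ≡ 1` (`κ′ ~ m`); at small curvature PART Ϧ's `κ = m² + treeGap` would improve them (not restated); crude absolute constants; NOT Bałaban's multi-level `G_k(U)` ∕ [B9] (3.42)
(`L^{−2k}` prefactors over `k` steps, `η`-lattice, axial-gauge trees); NOT a node discharge (N15 of record untouched); nothing continuum ∕ ℝ⁴ ∕ OS ∕ mass gap ∕ Clay.
PRIOR TREE ART (by name): Ϻ-f (`norm_blk_fullOpU_inv_sub_le_doubleSum`, `norm_blk_effLapU_le_mass`), Ϻ-c (`blockSum_lapF_inv_le_far`∕`_col_le_far`, `card_offsets_four`), Ϻ-b (`exists_leg_ge_third`,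
`inv_sq_le_near`, `exp_tail_le_far`, `sum_exp_neg_mul_tdistT_le`∕`'`), Ϻ-a (`blockSum_lapF_inv_nonneg`∕`_col_nonneg`, `sum_blockSum_lapF_inv_row`∕`_col`, `abs_doubleSum_le_of_abs_le`), Ϻ-d
(`king_fullProp_powerLaw_eta_uniform`), Ϣ-j (`king_green_powerLaw_tdistT`), R-a (`Curved.tdistT_fine_le_blocks`), Ͱ-b (`l2_opNorm_blk_inv_le`, `norm_entry_le_l2_opNorm_blk`), Ϧ (`ctRate`, `ctRate_pos`),
B4Sect5Proof (`latticeConst`, `latticeConst_nonneg`), `Beta.WoodburyFibre.cM`, `LatticeDiamagneticInequality.blk`.  Dedup (rg at filing): basename 0 files; needles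
`king_fullPropU_correction_powerLaw|king_fullPropU_powerLaw_eta_uniform|mul_doubleSum_le_powerLaw_of_decay|summand_le_three_terms_of_decay|doubleSum_le_far_of_decay|king_fullPropU_entry_powerLaw` 0 tree files.
presearch: as Ϻ-d (no in-tree or held statement of a one-level full-propagator law uniform in `L` at arbitrary unitary backgrounds; composition of in-tree theorems, no new Literature fact).
Locators: [King1986] C. King, CMP 102 (1986) 649–677: (2.13)–(2.14) p.653, (3.63) p.663, (4.33)–(4.34) p.674, (4.44)–(4.45) p.675; [Balaban1985BackgroundPropagators] (3.19) p.393, (3.23)–(3.26) p.394, Thm 3.1 ∕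
(3.42) p.397 (NOT asserted), Thm 3.4 p.400; [Balaban1984PropagatorsI] (1.29) p.23; [Dimock2013] App. D Lemmas 29–30; [DodziukMathai2006] Thm 1.5 §1.  0 `sorry`, 0 `def`.
-/

noncomputable section

open scoped BigOperators ComplexConjugate ComplexOrder Matrix.Norms.L2Operator
open Finset Matrix

namespace Summit.QuantumFields.YangMills.BalabanUVNodes.N15KingModelRung.HeatKernel

open Literature.MathematicalPhysics.QuantumFieldTheory.LatticeDiamagneticInequality (blk)
open Literature.MathematicalPhysics.QuantumFieldTheory.Balaban1983to89.B5Prop11Plancherel (Tor fine)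
open Literature.MathematicalPhysics.QuantumFieldTheory.Balaban1983to89.Beta.WoodburyFibre (cM)
open Literature.MathematicalPhysics.QuantumFieldTheory.Balaban1983to89 (B4Sect5Proof.latticeConst B4Sect5Proof.latticeConst_nonneg)
open Literature.MathematicalPhysics.QuantumFieldTheory.King1986.Torus (lapF blockSum site blockOf tdistT tdistT_nonneg tdistT_symm)
open Summit.QuantumFields.YangMills.BalabanUVNodes.N15KingModelRung.Covariant (covLapF l2_opNorm_blk_inv_le lapF_inv_entry_nonneg norm_entry_le_l2_opNorm_blk)
open Summit.QuantumFields.YangMills.BalabanUVNodes.N15KingModelRung.CovariantBlock (BlockTree fullOpU effLapU)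
open Summit.QuantumFields.YangMills.BalabanUVNodes.N15KingModelRung.CombesThomas (ctRate ctRate_pos)
open Summit.QuantumFields.YangMills.BalabanUVNodes.N15KingModelRung.Curved (tdistT_fine_le_blocks)

/-! ## §1 The three-leg books for an arbitrary decaying block kernel -/

section Generic

variable (L M₀ : ℕ) [NeZero L] [NeZero M₀] {m2 : ℝ}
variable {Δt : Tor (cM M₀) → Tor (cM M₀) → ℝ} {C κ : ℝ} (hΔ0 : ∀ b b', 0 ≤ Δt b b') (hC : 0 ≤ C) (hκ : 0 < κ) (hΔ : ∀ b b', Δt b b' ≤ C * Real.exp (-(κ * tdistT (cM M₀) b b')))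

omit [NeZero L] in
include hC hκ hΔ in
/-- Column sums of a decaying block kernel: `Σ_bΔ̃(b,b′) ≤ C·latticeConst 4 κ` (volume-free). [cite: Balaban1983RegularityDecay, §5 p.600] -/
theorem sum_le_of_exp_decay (b' : Tor (cM M₀)) : ∑ b, Δt b b' ≤ C * B4Sect5Proof.latticeConst 4 κ :=
  calc ∑ b, Δt b b' ≤ ∑ b, C * Real.exp (-(κ * tdistT (cM M₀) b b')) := Finset.sum_le_sum fun b _ => hΔ b b'
    _ = C * ∑ b, Real.exp (-(κ * tdistT (cM M₀) b b')) := by rw [Finset.mul_sum]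
    _ ≤ C * B4Sect5Proof.latticeConst 4 κ := mul_le_mul_of_nonneg_left (sum_exp_neg_mul_tdistT_le' (cM M₀) hκ b') hC

omit [NeZero L] in
include hC hκ hΔ in
/-- Row sums: `Σ_{b′}Δ̃(b,b′) ≤ C·latticeConst 4 κ`. [cite: Balaban1983RegularityDecay, §5 p.600] -/
theorem sum_le_of_exp_decay' (b : Tor (cM M₀)) : ∑ b', Δt b b' ≤ C * B4Sect5Proof.latticeConst 4 κ :=
  calc ∑ b', Δt b b' ≤ ∑ b', C * Real.exp (-(κ * tdistT (cM M₀) b b')) := Finset.sum_le_sum fun b' _ => hΔ b b'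
    _ = C * ∑ b', Real.exp (-(κ * tdistT (cM M₀) b b')) := by rw [Finset.mul_sum]
    _ ≤ C * B4Sect5Proof.latticeConst 4 κ := mul_le_mul_of_nonneg_left (sum_exp_neg_mul_tdistT_le (cM M₀) hκ b) hC

include hΔ0 hC hκ hΔ in
/-- ★★ THE POINTWISE THREE-TERM DOMINATION for a decaying block kernel (`D = dist_M(β_u,β_v) ≥ 6`): `S_u(b)Δ̃(b,b′)S^v(b′) ≤ S·Ce^{−κD∕3}·S′ + β·Δ̃·S′ + S·Δ̃·β`, `β = L⁴(49C₀∕L²)∕(1+dist(u,v)²)`.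
[cite: King1986, (4.34) p.674, (4.44)–(4.45) p.675] -/
theorem summand_le_three_terms_of_decay (hm : 0 < m2) (u v : Tor (fine L (cM M₀))) (hD : 6 ≤ tdistT (cM M₀) (blockOf L (cM M₀) u) (blockOf L (cM M₀) v)) (b b' : Tor (cM M₀)) :
    blockSum L (cM M₀) (fun x => (lapF (fine L (cM M₀)) ((L : ℝ) ^ 2) m2)⁻¹ u x) b * Δt b b' * blockSum L (cM M₀) (fun x => (lapF (fine L (cM M₀)) ((L : ℝ) ^ 2) m2)⁻¹ x v) b'
      ≤ blockSum L (cM M₀) (fun x => (lapF (fine L (cM M₀)) ((L : ℝ) ^ 2) m2)⁻¹ u x) b * (C * Real.exp (-(κ * (tdistT (cM M₀) (blockOf L (cM M₀) u) (blockOf L (cM M₀) v) / 3))))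
            * blockSum L (cM M₀) (fun x => (lapF (fine L (cM M₀)) ((L : ℝ) ^ 2) m2)⁻¹ x v) b'
        + ((L : ℝ) ^ 4 * ((49 * (34016 + 10 / m2) / (L : ℝ) ^ 2) / (1 + tdistT (fine L (cM M₀)) u v ^ 2))) * Δt b b'
            * blockSum L (cM M₀) (fun x => (lapF (fine L (cM M₀)) ((L : ℝ) ^ 2) m2)⁻¹ x v) b'
        + blockSum L (cM M₀) (fun x => (lapF (fine L (cM M₀)) ((L : ℝ) ^ 2) m2)⁻¹ u x) b * Δt b b'
            * ((L : ℝ) ^ 4 * ((49 * (34016 + 10 / m2) / (L : ℝ) ^ 2) / (1 + tdistT (fine L (cM M₀)) u v ^ 2))) := by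
  have hc : (0 : ℝ) ≤ (L : ℝ) ^ 2 := by positivity
  set S := blockSum L (cM M₀) (fun x => (lapF (fine L (cM M₀)) ((L : ℝ) ^ 2) m2)⁻¹ u x) b with hS
  set S' := blockSum L (cM M₀) (fun x => (lapF (fine L (cM M₀)) ((L : ℝ) ^ 2) m2)⁻¹ x v) b' with hS'
  set K := C * Real.exp (-(κ * (tdistT (cM M₀) (blockOf L (cM M₀) u) (blockOf L (cM M₀) v) / 3))) with hK
  set β := (L : ℝ) ^ 4 * ((49 * (34016 + 10 / m2) / (L : ℝ) ^ 2) / (1 + tdistT (fine L (cM M₀)) u v ^ 2)) with hβ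
  have hS0 : 0 ≤ S := blockSum_lapF_inv_nonneg L (cM M₀) hc hm u b
  have hS'0 : 0 ≤ S' := blockSum_lapF_inv_col_nonneg L (cM M₀) hc hm v b'
  have hΔ00 : 0 ≤ Δt b b' := hΔ0 b b'
  have hK0 : 0 ≤ K := mul_nonneg hC (Real.exp_pos _).le
  have hβ0 : 0 ≤ β := by positivity
  have hTA : 0 ≤ S * K * S' := by positivity
  have hTB : 0 ≤ β * Δt b b' * S' := by positivity
  have hTC : 0 ≤ S * Δt b b' * β := by positivity
  rcases exists_leg_ge_third (cM M₀) (blockOf L (cM M₀) u) (blockOf L (cM M₀) v) b b' with hA | hB | hC'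
  · have h1 : S ≤ β := blockSum_lapF_inv_le_far L M₀ hm u v b hD hA
    have : S * Δt b b' * S' ≤ β * Δt b b' * S' := mul_le_mul_of_nonneg_right (mul_le_mul_of_nonneg_right h1 hΔ00) hS'0
    linarith
  · have h1 : Δt b b' ≤ K := (hΔ b b').trans (mul_le_mul_of_nonneg_left (Real.exp_le_exp.mpr (by nlinarith)) hC)
    have : S * Δt b b' * S' ≤ S * K * S' := mul_le_mul_of_nonneg_right (mul_le_mul_of_nonneg_left h1 hS0) hS'0
    linarith
  · have h1 : S' ≤ β := blockSum_lapF_inv_col_le_far L M₀ hm u v b' hD hC'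
    have : S * Δt b b' * S' ≤ S * Δt b b' * β := mul_le_mul_of_nonneg_left h1 (mul_nonneg hS0 hΔ00)
    linarith

include hΔ0 hC hκ hΔ in
/-- ★★ THE FAR DOUBLE SUM for a decaying block kernel (`D ≥ 6`): `ΣΣ S_uΔ̃S^v ≤ Ce^{−κD∕3}∕m⁴ + 2·β·C·latticeConst 4 κ∕m²`. [cite: King1986, (4.34) p.674, (4.44)–(4.45) p.675; Balaban1983RegularityDecay, §5 p.600] -/
theorem doubleSum_le_far_of_decay (hm : 0 < m2) (u v : Tor (fine L (cM M₀))) (hD : 6 ≤ tdistT (cM M₀) (blockOf L (cM M₀) u) (blockOf L (cM M₀) v)) :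
    ∑ b, ∑ b', blockSum L (cM M₀) (fun x => (lapF (fine L (cM M₀)) ((L : ℝ) ^ 2) m2)⁻¹ u x) b * Δt b b' * blockSum L (cM M₀) (fun x => (lapF (fine L (cM M₀)) ((L : ℝ) ^ 2) m2)⁻¹ x v) b'
      ≤ C * Real.exp (-(κ * (tdistT (cM M₀) (blockOf L (cM M₀) u) (blockOf L (cM M₀) v) / 3))) / m2 ^ 2
        + 2 * (((L : ℝ) ^ 4 * ((49 * (34016 + 10 / m2) / (L : ℝ) ^ 2) / (1 + tdistT (fine L (cM M₀)) u v ^ 2))) * (C * B4Sect5Proof.latticeConst 4 κ) / m2) := by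
  have hc : (0 : ℝ) ≤ (L : ℝ) ^ 2 := by positivity
  set S := fun b => blockSum L (cM M₀) (fun x => (lapF (fine L (cM M₀)) ((L : ℝ) ^ 2) m2)⁻¹ u x) b with hS
  set S' := fun b' => blockSum L (cM M₀) (fun x => (lapF (fine L (cM M₀)) ((L : ℝ) ^ 2) m2)⁻¹ x v) b' with hS'
  set K := C * Real.exp (-(κ * (tdistT (cM M₀) (blockOf L (cM M₀) u) (blockOf L (cM M₀) v) / 3))) with hK
  set β := (L : ℝ) ^ 4 * ((49 * (34016 + 10 / m2) / (L : ℝ) ^ 2) / (1 + tdistT (fine L (cM M₀)) u v ^ 2)) with hβ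
  set CS := C * B4Sect5Proof.latticeConst 4 κ with hCS
  have hsumS : ∑ b, S b = m2⁻¹ := sum_blockSum_lapF_inv_row L (cM M₀) hc hm u
  have hsumS' : ∑ b', S' b' = m2⁻¹ := sum_blockSum_lapF_inv_col L (cM M₀) hc hm v
  have hS0 : ∀ b, 0 ≤ S b := fun b => blockSum_lapF_inv_nonneg L (cM M₀) hc hm u b
  have hS'0 : ∀ b', 0 ≤ S' b' := fun b' => blockSum_lapF_inv_col_nonneg L (cM M₀) hc hm v b'
  have hβ0 : 0 ≤ β := by positivity
  have hrow : ∀ b', ∑ b, Δt b b' ≤ CS := fun b' => sum_le_of_exp_decay M₀ hC hκ hΔ b'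
  have hcol : ∀ b, ∑ b', Δt b b' ≤ CS := fun b => sum_le_of_exp_decay' M₀ hC hκ hΔ b
  have h1 : ∑ b, ∑ b', S b * Δt b b' * S' b' ≤ ∑ b, ∑ b', (S b * K * S' b' + β * Δt b b' * S' b' + S b * Δt b b' * β) :=
    Finset.sum_le_sum fun b _ => Finset.sum_le_sum fun b' _ => summand_le_three_terms_of_decay L M₀ hΔ0 hC hκ hΔ hm u v hD b b'
  have hA : ∑ b, ∑ b', S b * K * S' b' = K / m2 ^ 2 := by
    have e : ∑ b, ∑ b', S b * K * S' b' = K * (∑ b, S b) * (∑ b', S' b') := by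
      rw [mul_assoc, Finset.sum_mul_sum, Finset.mul_sum]
      refine Finset.sum_congr rfl fun b _ => ?_
      rw [Finset.mul_sum]
      exact Finset.sum_congr rfl fun b' _ => by ring
    rw [e, hsumS, hsumS']; field_simp
  have hB : ∑ b, ∑ b', β * Δt b b' * S' b' ≤ β * CS / m2 := by
    calc ∑ b, ∑ b', β * Δt b b' * S' b' = β * ∑ b', S' b' * (∑ b, Δt b b') := by
          rw [Finset.sum_comm, Finset.mul_sum]
          refine Finset.sum_congr rfl fun b' _ => ?_
          rw [Finset.mul_sum, Finset.mul_sum]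
          exact Finset.sum_congr rfl fun b _ => by ring
      _ ≤ β * ∑ b', S' b' * CS := mul_le_mul_of_nonneg_left (Finset.sum_le_sum fun b' _ => mul_le_mul_of_nonneg_left (hrow b') (hS'0 b')) hβ0
      _ = β * CS / m2 := by rw [← Finset.sum_mul, hsumS']; field_simp
  have hCC : ∑ b, ∑ b', S b * Δt b b' * β ≤ β * CS / m2 := by
    calc ∑ b, ∑ b', S b * Δt b b' * β = β * ∑ b, S b * (∑ b', Δt b b') := by
          rw [Finset.mul_sum]
          refine Finset.sum_congr rfl fun b _ => ?_
          rw [Finset.mul_sum, Finset.mul_sum]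
          exact Finset.sum_congr rfl fun b' _ => by ring
      _ ≤ β * ∑ b, S b * CS := mul_le_mul_of_nonneg_left (Finset.sum_le_sum fun b _ => mul_le_mul_of_nonneg_left (hcol b) (hS0 b)) hβ0
      _ = β * CS / m2 := by rw [← Finset.sum_mul, hsumS]; field_simp
  have hsplit : ∑ b, ∑ b', (S b * K * S' b' + β * Δt b b' * S' b' + S b * Δt b b' * β)
      = (∑ b, ∑ b', S b * K * S' b') + (∑ b, ∑ b', β * Δt b b' * S' b') + (∑ b, ∑ b', S b * Δt b b' * β) := by
    rw [← Finset.sum_add_distrib, ← Finset.sum_add_distrib]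
    refine Finset.sum_congr rfl fun b _ => ?_
    rw [← Finset.sum_add_distrib, ← Finset.sum_add_distrib]
  calc ∑ b, ∑ b', S b * Δt b b' * S' b' ≤ _ := h1
    _ = _ := hsplit
    _ ≤ K / m2 ^ 2 + β * CS / m2 + β * CS / m2 := by rw [hA]; exact add_le_add (add_le_add le_rfl hB) hCC
    _ = K / m2 ^ 2 + 2 * (β * CS / m2) := by ring

include hΔ0 hC hκ hΔ in
/-- ★★★ **THE INVERSE-SQUARE LAW FOR THE SCALAR DOUBLE SUM AGAINST ANY DECAYING BLOCK KERNEL**: for ALL `u, v`, every `L ≥ 1`, every `M₀ ≥ 1`,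
`L²·L^{−4}·Σ_{b,b′}S_u(b)Δ̃(b,b′)S^v(b′) ≤ (98(34016+10∕m²)·C·S_κ∕m² + 50C(1+κ⁻²)∕m⁴)∕(1 + dist(u,v)²)` (`S_κ = latticeConst 4 κ`; near zone `D < 6`: `ΣΣ ≤ C∕m⁴`; far zone: the three legs).
[cite: King1986, (2.13)–(2.14) p.653, (4.34) p.674, (4.44)–(4.45) p.675; Balaban1983RegularityDecay, §5 p.600] -/
theorem mul_doubleSum_le_powerLaw_of_decay (hm : 0 < m2) (u v : Tor (fine L (cM M₀))) :
    (L : ℝ) ^ 2 * (((L : ℝ) ^ 4)⁻¹ * ∑ b, ∑ b', blockSum L (cM M₀) (fun x => (lapF (fine L (cM M₀)) ((L : ℝ) ^ 2) m2)⁻¹ u x) b * Δt b b'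
        * blockSum L (cM M₀) (fun x => (lapF (fine L (cM M₀)) ((L : ℝ) ^ 2) m2)⁻¹ x v) b')
      ≤ (98 * (34016 + 10 / m2) * (C * B4Sect5Proof.latticeConst 4 κ) / m2 + 50 * C * (1 + (κ ^ 2)⁻¹) / m2 ^ 2) / (1 + tdistT (fine L (cM M₀)) u v ^ 2) := by
  have hL1 : (1 : ℝ) ≤ L := by exact_mod_cast Nat.one_le_iff_ne_zero.mpr (NeZero.ne L)
  have hL0 : (0 : ℝ) < L := by positivity
  have hc : (0 : ℝ) ≤ (L : ℝ) ^ 2 := by positivity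
  have ht0 := tdistT_nonneg (fine L (cM M₀)) u v
  have ht := tdistT_fine_le_blocks L (cM M₀) u v
  set t := tdistT (fine L (cM M₀)) u v with htdef
  set D := tdistT (cM M₀) (blockOf L (cM M₀) u) (blockOf L (cM M₀) v) with hDdef
  set C0 : ℝ := 34016 + 10 / m2 with hC0
  set CS := C * B4Sect5Proof.latticeConst 4 κ with hCS
  have hC00 : 0 ≤ C0 := by positivity
  have hCS0 : 0 ≤ CS := mul_nonneg hC (B4Sect5Proof.latticeConst_nonneg 4 hκ.le)
  have hκ2 : 0 < κ ^ 2 := pow_pos hκ 2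
  have hm2 : 0 < m2 ^ 2 := by positivity
  have htpos : 0 < 1 + t ^ 2 := by positivity
  have hS0 := blockSum_lapF_inv_nonneg L (cM M₀) hc hm u
  have hS'0 := blockSum_lapF_inv_col_nonneg L (cM M₀) hc hm v
  -- the united constant dominates both zone constants
  have hfar_le : 98 * C0 * CS / m2 + 50 * C / (κ ^ 2 * m2 ^ 2) ≤ 98 * C0 * CS / m2 + 50 * C * (1 + (κ ^ 2)⁻¹) / m2 ^ 2 := by
    have e : 50 * C / (κ ^ 2 * m2 ^ 2) = 50 * C * (κ ^ 2)⁻¹ / m2 ^ 2 := by field_simp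
    rw [e]
    have : 50 * C * (κ ^ 2)⁻¹ / m2 ^ 2 ≤ 50 * C * (1 + (κ ^ 2)⁻¹) / m2 ^ 2 :=
      div_le_div_of_nonneg_right (mul_le_mul_of_nonneg_left (by linarith) (by positivity)) hm2.le
    linarith
  have hnear_le : 50 * C / m2 ^ 2 ≤ 98 * C0 * CS / m2 + 50 * C * (1 + (κ ^ 2)⁻¹) / m2 ^ 2 := by
    have h1 : 0 ≤ 98 * C0 * CS / m2 := by positivity
    have h2 : 50 * C / m2 ^ 2 ≤ 50 * C * (1 + (κ ^ 2)⁻¹) / m2 ^ 2 :=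
      div_le_div_of_nonneg_right (le_mul_of_one_le_right (by positivity) (by linarith [inv_nonneg.mpr hκ2.le])) hm2.le
    linarith
  rcases lt_or_ge D 6 with hD | hD
  · -- near zone: `ΣΣ ≤ C∕m⁴` and `1∕L² ≤ 50∕(1+t²)`
    have hK : ∀ b b', |Δt b b'| ≤ C := fun b b' => by
      rw [abs_of_nonneg (hΔ0 b b')]
      refine (hΔ b b').trans ?_
      have : Real.exp (-(κ * tdistT (cM M₀) b b')) ≤ 1 := by
        rw [Real.exp_le_one_iff, neg_nonpos]; exact mul_nonneg hκ.le (tdistT_nonneg (cM M₀) b b')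
      nlinarith
    have hsum := abs_doubleSum_le_of_abs_le (cM M₀) hS0 hS'0 hK
    rw [sum_blockSum_lapF_inv_row L (cM M₀) hc hm u, sum_blockSum_lapF_inv_col L (cM M₀) hc hm v] at hsum
    have hsum' : ∑ b, ∑ b', blockSum L (cM M₀) (fun x => (lapF (fine L (cM M₀)) ((L : ℝ) ^ 2) m2)⁻¹ u x) b * Δt b b'
        * blockSum L (cM M₀) (fun x => (lapF (fine L (cM M₀)) ((L : ℝ) ^ 2) m2)⁻¹ x v) b' ≤ C / m2 ^ 2 := by
      refine (le_abs_self _).trans (hsum.trans (le_of_eq ?_)); field_simp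
    have hconv := inv_sq_le_near hL1 hD ht0 ht
    calc (L : ℝ) ^ 2 * (((L : ℝ) ^ 4)⁻¹ * ∑ b, ∑ b', blockSum L (cM M₀) (fun x => (lapF (fine L (cM M₀)) ((L : ℝ) ^ 2) m2)⁻¹ u x) b * Δt b b'
            * blockSum L (cM M₀) (fun x => (lapF (fine L (cM M₀)) ((L : ℝ) ^ 2) m2)⁻¹ x v) b')
        ≤ (L : ℝ) ^ 2 * (((L : ℝ) ^ 4)⁻¹ * (C / m2 ^ 2)) := mul_le_mul_of_nonneg_left (mul_le_mul_of_nonneg_left hsum' (by positivity)) hc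
      _ = (C / m2 ^ 2) * (1 / (L : ℝ) ^ 2) := by field_simp
      _ ≤ (C / m2 ^ 2) * (50 / (1 + t ^ 2)) := mul_le_mul_of_nonneg_left hconv (by positivity)
      _ = (50 * C / m2 ^ 2) / (1 + t ^ 2) := by ring
      _ ≤ _ := div_le_div_of_nonneg_right hnear_le htpos.le
  · -- far zone: the three legs
    have hsum := doubleSum_le_far_of_decay L M₀ hΔ0 hC hκ hΔ hm u v hD
    have htail := exp_tail_le_far hL1 hD ht0 ht hκ
    calc (L : ℝ) ^ 2 * (((L : ℝ) ^ 4)⁻¹ * ∑ b, ∑ b', blockSum L (cM M₀) (fun x => (lapF (fine L (cM M₀)) ((L : ℝ) ^ 2) m2)⁻¹ u x) b * Δt b b'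
            * blockSum L (cM M₀) (fun x => (lapF (fine L (cM M₀)) ((L : ℝ) ^ 2) m2)⁻¹ x v) b')
        ≤ (L : ℝ) ^ 2 * (((L : ℝ) ^ 4)⁻¹ * (C * Real.exp (-(κ * (D / 3))) / m2 ^ 2 + 2 * (((L : ℝ) ^ 4 * ((49 * C0 / (L : ℝ) ^ 2) / (1 + t ^ 2))) * CS / m2))) :=
          mul_le_mul_of_nonneg_left (mul_le_mul_of_nonneg_left hsum (by positivity)) hc
      _ = (C / m2 ^ 2) * (Real.exp (-(κ * (D / 3))) / (L : ℝ) ^ 2) + (98 * C0 * CS / m2) * (1 / (1 + t ^ 2)) := by field_simp; ring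
      _ ≤ (C / m2 ^ 2) * ((50 / κ ^ 2) / (1 + t ^ 2)) + (98 * C0 * CS / m2) * (1 / (1 + t ^ 2)) := by gcongr
      _ = (98 * C0 * CS / m2 + 50 * C / (κ ^ 2 * m2 ^ 2)) / (1 + t ^ 2) := by field_simp; ring
      _ ≤ _ := div_le_div_of_nonneg_right hfar_le htpos.le

end Generic

/-! ## §2 ★★★★ The full background propagator at every unitary link field -/

section Curved

variable {L : ℕ} [NeZero L] (T : BlockTree 3 L) (M₀ : ℕ) [NeZero M₀]
variable {𝕜 : Type*} [RCLike 𝕜] {n : Type*} [Fintype n] [DecidableEq n] {a m2 : ℝ}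

/-- ★★★★ **THE CURVED BLOCK CORRECTION OBEYS THE INVERSE-SQUARE LAW, UNIFORMLY IN `η` AND IN THE BACKGROUND**: for every tree contour system, EVERY unitary `U`, ALL `u, v ∈ (ℤ∕LM₀)⁴`, every `L ≥ 1`, every `M₀ ≥ 1`:
`L²·‖(A₀(U)⁻¹)_{uv} − (M_U⁻¹)_{uv}‖ ≤ (98(34016+10∕m²)C′S′∕m² + 50C′(1+κ′⁻²)∕m⁴)∕(1 + dist(u,v)²)`, `C′ = a + 2a²e²∕m²`, `κ′ = ctRate(m²,a,3)`, `S′ = latticeConst 4 κ′`.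
[cite: King1986, (2.13)–(2.14) p.653, (4.34) p.674, (4.44)–(4.45) p.675; Balaban1985BackgroundPropagators, (3.24)–(3.25) p.394; Dimock2013, App. D Lemma 30; DodziukMathai2006, Thm 1.5 §1] -/
theorem king_fullPropU_correction_powerLaw (ha : 0 < a) (hm : 0 < m2) {U : Tor (fine L (cM M₀)) × Fin 4 → Matrix n n 𝕜} (hU : ∀ bd, U bd ∈ Matrix.unitaryGroup n 𝕜)
    (u v : Tor (fine L (cM M₀))) :
    (L : ℝ) ^ 2 * ‖blk ((fullOpU T (cM M₀) a ((L : ℝ) ^ 2) m2 U)⁻¹) u v - blk ((covLapF (fine L (cM M₀)) ((L : ℝ) ^ 2) m2 U)⁻¹) u v‖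
      ≤ (98 * (34016 + 10 / m2) * ((a + a ^ 2 * (2 / m2) * Real.exp 2) * B4Sect5Proof.latticeConst 4 (ctRate m2 a 3)) / m2
          + 50 * (a + a ^ 2 * (2 / m2) * Real.exp 2) * (1 + (ctRate m2 a 3 ^ 2)⁻¹) / m2 ^ 2) / (1 + tdistT (fine L (cM M₀)) u v ^ 2) := by
  have hc : (0 : ℝ) ≤ (L : ℝ) ^ 2 := by positivity
  have hdom := norm_blk_fullOpU_inv_sub_le_doubleSum T (cM M₀) ha hc hm hU u v
  have hL31 : ((L : ℝ) ^ (3 + 1))⁻¹ = ((L : ℝ) ^ 4)⁻¹ := by norm_num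
  rw [hL31] at hdom
  have hC' : 0 ≤ a + a ^ 2 * (2 / m2) * Real.exp 2 := by positivity
  have hgen := mul_doubleSum_le_powerLaw_of_decay L M₀ (Δt := fun b b' => ‖blk (effLapU T (cM M₀) a ((L : ℝ) ^ 2) m2 U) b b'‖)
    (fun _ _ => norm_nonneg _) hC' (ctRate_pos hm ha.le 3) (fun b b' => norm_blk_effLapU_le_mass T (cM M₀) ha.le hm hU b b') hm u v
  exact (mul_le_mul_of_nonneg_left hdom hc).trans hgen

/-- ★★★★ **THE η-UNIFORM INVERSE-SQUARE LAW FOR THE FULL BACKGROUND PROPAGATOR AT EVERY UNITARY LINK FIELD**: for every tree contour system `T`, EVERY unitary `U` on the fine four-torus `(ℤ∕LM₀)⁴`, ALL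
`u, v`, EVERY `L ≥ 1`, EVERY `M₀ ≥ 1`, any `RCLike` fibre: `L²·‖((−L²Δ_U + m² + aQ(U)^*Q(U))⁻¹)_{uv}‖ ≤ C^U_full(a,m²)∕(1 + dist(u,v)²)`,
`C^U_full = (34016+10∕m²)(1 + 98C′S′∕m²) + 50C′(1+κ′⁻²)∕m⁴` — constants depending on `(a, m²)` ONLY (Kato + Ϣ-j for the covariance layer; §1 for the block correction).
[cite: King1986, (2.13)–(2.14) p.653, (3.63) p.663, (4.33)–(4.34) p.674, (4.44)–(4.45) p.675; Balaban1985BackgroundPropagators, (3.23)–(3.26) p.394, Thm 3.4 p.400; Dimock2013, App. D Lemmas 29–30] -/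
theorem king_fullPropU_powerLaw_eta_uniform (ha : 0 < a) (hm : 0 < m2) {U : Tor (fine L (cM M₀)) × Fin 4 → Matrix n n 𝕜} (hU : ∀ bd, U bd ∈ Matrix.unitaryGroup n 𝕜)
    (u v : Tor (fine L (cM M₀))) :
    (L : ℝ) ^ 2 * ‖blk ((fullOpU T (cM M₀) a ((L : ℝ) ^ 2) m2 U)⁻¹) u v‖
      ≤ ((34016 + 10 / m2) * (1 + 98 * ((a + a ^ 2 * (2 / m2) * Real.exp 2) * B4Sect5Proof.latticeConst 4 (ctRate m2 a 3)) / m2)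
          + 50 * (a + a ^ 2 * (2 / m2) * Real.exp 2) * (1 + (ctRate m2 a 3 ^ 2)⁻¹) / m2 ^ 2) / (1 + tdistT (fine L (cM M₀)) u v ^ 2) := by
  have hc : (0 : ℝ) ≤ (L : ℝ) ^ 2 := by positivity
  have hT := king_fullPropU_correction_powerLaw T M₀ ha hm hU u v
  -- the covariance layer: Kato + Ϣ-j
  have hG : (L : ℝ) ^ 2 * ‖blk ((covLapF (fine L (cM M₀)) ((L : ℝ) ^ 2) m2 U)⁻¹) u v‖ ≤ (34016 + 10 / m2) / (1 + tdistT (fine L (cM M₀)) u v ^ 2) := by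
    have h1 := l2_opNorm_blk_inv_le (fine L (cM M₀)) hc hm hU u v
    have h2 := king_green_powerLaw_tdistT L M₀ hm u v
    have h3 : (lapF (fine L (cM M₀)) ((L : ℝ) ^ 2) m2)⁻¹ u v ≤ |(lapF (fine L (cM M₀)) ((L : ℝ) ^ 2) m2)⁻¹ u v| := le_abs_self _
    nlinarith [norm_nonneg (blk ((covLapF (fine L (cM M₀)) ((L : ℝ) ^ 2) m2 U)⁻¹) u v)]
  have htri : ‖blk ((fullOpU T (cM M₀) a ((L : ℝ) ^ 2) m2 U)⁻¹) u v‖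
      ≤ ‖blk ((covLapF (fine L (cM M₀)) ((L : ℝ) ^ 2) m2 U)⁻¹) u v‖ + ‖blk ((fullOpU T (cM M₀) a ((L : ℝ) ^ 2) m2 U)⁻¹) u v - blk ((covLapF (fine L (cM M₀)) ((L : ℝ) ^ 2) m2 U)⁻¹) u v‖ := by
    have := norm_add_le (blk ((covLapF (fine L (cM M₀)) ((L : ℝ) ^ 2) m2 U)⁻¹) u v)
      (blk ((fullOpU T (cM M₀) a ((L : ℝ) ^ 2) m2 U)⁻¹) u v - blk ((covLapF (fine L (cM M₀)) ((L : ℝ) ^ 2) m2 U)⁻¹) u v)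
    rwa [add_sub_cancel] at this
  calc (L : ℝ) ^ 2 * ‖blk ((fullOpU T (cM M₀) a ((L : ℝ) ^ 2) m2 U)⁻¹) u v‖
      ≤ (L : ℝ) ^ 2 * ‖blk ((covLapF (fine L (cM M₀)) ((L : ℝ) ^ 2) m2 U)⁻¹) u v‖
          + (L : ℝ) ^ 2 * ‖blk ((fullOpU T (cM M₀) a ((L : ℝ) ^ 2) m2 U)⁻¹) u v - blk ((covLapF (fine L (cM M₀)) ((L : ℝ) ^ 2) m2 U)⁻¹) u v‖ := by
        rw [← mul_add]; exact mul_le_mul_of_nonneg_left htri hc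
    _ ≤ _ := add_le_add hG hT
    _ = _ := by rw [← add_div]; congr 1; ring

/-- ★★★ **EVERY FIBRE ENTRY**: `L²·‖(A₀(U)⁻¹)_{(u,i),(v,j)}‖ ≤ C^U_full(a,m²)∕(1 + dist(u,v)²)` (an entry is dominated by the operator norm of its block, Ͱ-b `norm_entry_le_l2_opNorm_blk`).
[cite: Balaban1985BackgroundPropagators, (3.23)–(3.26) p.394, (3.42) p.397; King1986, (2.13) p.653] -/
theorem king_fullPropU_entry_powerLaw (ha : 0 < a) (hm : 0 < m2) {U : Tor (fine L (cM M₀)) × Fin 4 → Matrix n n 𝕜} (hU : ∀ bd, U bd ∈ Matrix.unitaryGroup n 𝕜)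
    (u v : Tor (fine L (cM M₀))) (i j : n) :
    (L : ℝ) ^ 2 * ‖(fullOpU T (cM M₀) a ((L : ℝ) ^ 2) m2 U)⁻¹ (u, i) (v, j)‖
      ≤ ((34016 + 10 / m2) * (1 + 98 * ((a + a ^ 2 * (2 / m2) * Real.exp 2) * B4Sect5Proof.latticeConst 4 (ctRate m2 a 3)) / m2)
          + 50 * (a + a ^ 2 * (2 / m2) * Real.exp 2) * (1 + (ctRate m2 a 3 ^ 2)⁻¹) / m2 ^ 2) / (1 + tdistT (fine L (cM M₀)) u v ^ 2) :=
  (mul_le_mul_of_nonneg_left (norm_entry_le_l2_opNorm_blk (fine L (cM M₀)) _ u v i j) (by positivity)).trans (king_fullPropU_powerLaw_eta_uniform T M₀ ha hm hU u v)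

end Curved

/-- ★★★ **THE ORDER OF QUANTIFIERS AT CURVED FIELDS**: ONE constant `C = C(a,m²) > 0` serves EVERY `L ≥ 1`, EVERY `M₀ ≥ 1`, EVERY tree contour system, EVERY unitary `U` (fibre `𝕜ⁿ` fixed) and all `u, v`.
[cite: King1986, (2.13)–(2.14) p.653, (3.63) p.663; Balaban1985BackgroundPropagators, Thm 3.1 p.397 (shape, one level)] -/
theorem king_fullPropU_powerLaw_exists {𝕜 : Type*} [RCLike 𝕜] {n : Type*} [Fintype n] [DecidableEq n] {a m2 : ℝ} (ha : 0 < a) (hm : 0 < m2) :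
    ∃ C : ℝ, 0 < C ∧ ∀ (L M₀ : ℕ) [NeZero L] [NeZero M₀] (T : BlockTree 3 L) (U : Tor (fine L (cM M₀)) × Fin 4 → Matrix n n 𝕜), (∀ bd, U bd ∈ Matrix.unitaryGroup n 𝕜) →
      ∀ u v : Tor (fine L (cM M₀)), (L : ℝ) ^ 2 * ‖blk ((fullOpU T (cM M₀) a ((L : ℝ) ^ 2) m2 U)⁻¹) u v‖ ≤ C / (1 + tdistT (fine L (cM M₀)) u v ^ 2) := by
  refine ⟨(34016 + 10 / m2) * (1 + 98 * ((a + a ^ 2 * (2 / m2) * Real.exp 2) * B4Sect5Proof.latticeConst 4 (ctRate m2 a 3)) / m2)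
      + 50 * (a + a ^ 2 * (2 / m2) * Real.exp 2) * (1 + (ctRate m2 a 3 ^ 2)⁻¹) / m2 ^ 2, ?_,
    fun L M₀ _ _ T U hU u v => king_fullPropU_powerLaw_eta_uniform T M₀ ha hm hU u v⟩
  have hCS : 0 ≤ (a + a ^ 2 * (2 / m2) * Real.exp 2) * B4Sect5Proof.latticeConst 4 (ctRate m2 a 3) :=
    mul_nonneg (by positivity) (B4Sect5Proof.latticeConst_nonneg 4 (ctRate_pos hm ha.le 3).le)
  have hκ2 : 0 ≤ (ctRate m2 a 3 ^ 2)⁻¹ := inv_nonneg.mpr (pow_pos (ctRate_pos hm ha.le 3) 2).le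
  positivity

/-- ★★★ **WHAT THE CURVED CASE ADDS FOR THE FULL PROPAGATOR — THE FINAL WORD** (side by side): at `U ≡ 1` (scalar) Ϻ-d's law with King's flat decay constants `(C_Δ, κ_A)`; at EVERY unitary `U` the same law
with the mass-floor constants `(a + 2a²e²∕m², ctRate(m²,a,3))` — nothing else changes. [cite: King1986, (2.13)–(2.14) p.653, (4.34) p.674; Balaban1985BackgroundPropagators, Thm 3.1 p.397, (3.23) p.394] -/
theorem king_fullProp_what_the_curved_case_adds_final {L : ℕ} [NeZero L] (T : BlockTree 3 L) (M₀ : ℕ) [NeZero M₀] {𝕜 : Type*} [RCLike 𝕜] {n : Type*} [Fintype n] [DecidableEq n]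
    {a m2 : ℝ} (ha : 0 < a) (hm : 0 < m2) {U : Tor (fine L (cM M₀)) × Fin 4 → Matrix n n 𝕜} (hU : ∀ bd, U bd ∈ Matrix.unitaryGroup n 𝕜) (u v : Tor (fine L (cM M₀))) :
    (L : ℝ) ^ 2 * |(Literature.MathematicalPhysics.QuantumFieldTheory.King1986.Torus.fineOp L (cM M₀) a ((L : ℝ) ^ 2) m2)⁻¹ u v|
        ≤ ((34016 + 10 / m2) * (1 + 98 * (Literature.MathematicalPhysics.QuantumFieldTheory.King1986.Torus.CDelta a 4
              * B4Sect5Proof.latticeConst 4 (Literature.MathematicalPhysics.QuantumFieldTheory.King1986.Torus.kapA a 4)) / m2)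
            + 50 * Literature.MathematicalPhysics.QuantumFieldTheory.King1986.Torus.CDelta a 4 * (1 + (Literature.MathematicalPhysics.QuantumFieldTheory.King1986.Torus.kapA a 4 ^ 2)⁻¹) / m2 ^ 2)
          / (1 + tdistT (fine L (cM M₀)) u v ^ 2)
      ∧ (L : ℝ) ^ 2 * ‖blk ((fullOpU T (cM M₀) a ((L : ℝ) ^ 2) m2 U)⁻¹) u v‖
        ≤ ((34016 + 10 / m2) * (1 + 98 * ((a + a ^ 2 * (2 / m2) * Real.exp 2) * B4Sect5Proof.latticeConst 4 (ctRate m2 a 3)) / m2)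
            + 50 * (a + a ^ 2 * (2 / m2) * Real.exp 2) * (1 + (ctRate m2 a 3 ^ 2)⁻¹) / m2 ^ 2) / (1 + tdistT (fine L (cM M₀)) u v ^ 2) :=
  ⟨king_fullProp_powerLaw_eta_uniform L M₀ ha hm u v, king_fullPropU_powerLaw_eta_uniform T M₀ ha hm hU u v⟩

end Summit.QuantumFields.YangMills.BalabanUVNodes.N15KingModelRung.HeatKernel

end
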